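/-
Copyright (c) 2026. All rights reserved.
Released under Apache 2.0 license as described in the file LICENSE.
Authors: abc-iut cell, prover seat abc-iut-L4-t10 (gen 14; row «COR510iv-HOL-MONO-CLOSE», abc-iut-L4-lead m174 (2)), over
abc-iut-f-101's `DiagramOverTransport` (`OverIso`) and this seat's `LogFrobeniusHolMonoSuperOver` (consumed BY NAME, nothing restated).
-/
import Literature.AnabelianGeometry.AbsoluteAnabelian.LogFrobeniusHolMonoSuperOver
import HarnessLib

/-!
# [AbsTopIII] Cor 5.10 (iv)(c): inside the common super-diagram, the homotopies of `D_{An•}` over `Th•[Z]` lie over the core `An⊢[𝒩⊢⊞]`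

S. Mochizuki, *Topics in absolute anabelian geometry III: global reconstruction algorithms* [MochizukiAbsTopIII2015];
manuscript `paper:url-5493eb38cbb7`, read on the page: Cor 5.10 (iv)(c) p. 148 l. 41–45 («… compatible with the telecore and contact
structures `𝔗_{An•}`, `ℋ_{An•}` of Corollary 5.5, (ii)»), Cor 5.10 preamble p. 146 (the mono-analyticisation arrows `D• → D⊢` and their
homotopies), Rmk 3.5.1 p. 78 (structure functors: «the 'constant portion' of the diagram that lies … 'under the entire diagram'»).

PROOF-SIDE file 2/3 of the CLOSER of abc-iut-L4-d3's `LogFrobeniusSetting.Cor510MonoContactHolCompatible` (row «COR510iv-HOL-MONO-CLOSE»).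
File 1 (`LogFrobeniusHolMonoSuperOver`) put the common super-diagram over the core `An⊢[𝒩⊢⊞]` (`supOver`) and read abc-iut-L4-t5's PLAIN
structure functors of `D_{An•}` over `Th•[Z]` on the pulled-back presentation (`holOverE`).  Here:

* `holβ`, `holSupOverIso` — abc-iut-L4-t5's structure functors over `Th•[Z]` followed by `Th•[Z] → ℰ⊢ ⥲ An⊢` ARE, vertex by vertex,
  the structure functors of the super-diagram over the core (abc-iut-f-101's `coreStructFunctor` table = abc-iut-L4-t5's `baseN` table
  mono-analyticised), and — edge by edge — the over-isomorphisms correspond (`logOver`, the unitors, `lamOver`, the unit of `κ_{An•}`,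
  `φ_{An•} ⋙ proj ≅ κ_{An•}⁻¹`): an ISOMORPHISM OF STRUCTURE DATA in the sense of abc-iut-f-101's `OverIso`, with identity components;
* ★ `isOver_sup_of_isOver_hol` — **every homotopy of `D_{An•}` lying over `Th•[Z]` is, read in the super-diagram, a homotopy lying over
  the core `An⊢[𝒩⊢⊞]`** (`IsOver.map`, `OverIso.isOver`, abc-iut-w6-d023's `pathIso_comapAlong`) — the fact that lets the telecore family
  `𝒥_{An•}` (lifts through `κ_{An•}⁻¹`) be pushed into the mono-analytic core in file 3.

HONEST FRAMING: OUR kernel constructions over abc-iut-L4-t3's typed §5 interface, under the printed data (a) `hN`, (c) `hψ` as hypotheses;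
refereed pre-IUT material; nothing here bears on [IUTchIII] Cor. 3.12; no side taken; typed ≠ proved.
-/

set_option autoImplicit false

universe u

open CategoryTheory Quiver

namespace Literature.AnabelianGeometry.AbsoluteAnabelian

namespace LogFrobeniusSetting

open DiagramOfCategories

variable {Vmod : Type u} {isArc : Vmod → Bool} (L : LogFrobeniusSetting Vmod isArc)

/-! ## The holomorphic structure functors, mono-analyticised, are isomorphic structure data to the restriction of `supOver` -/

section Transfer

variable (hN : ∀ v : Vmod, L.monoN v ⋙ L.toEmono v ≅ L.toE v ⋙ L.monoAn)
  (hψ : ∀ (w : Vmod) (j : {ν : LogVertex (isArc w) // ν.IsCross}),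
    L.ψAnMono w j ⋙ L.forgetMono w ⋙ L.toEmono w ≅ L.κAnMono.inverse)

/-- The mono-analyticisation of the base point: `Th•[Z] → ℰ⊢ ⥲ An⊢[𝒩⊢⊞]`. [cite: MochizukiAbsTopIII2015, Cor 5.10 p. 146] -/
abbrev toCoreMono : L.E ⥤ L.AnMono := L.monoAn ⋙ L.κAnMono.functor

section Algebra

variable {B C D : Type*} [Category B] [Category C] [Category D]

/-- Bookkeeping (all objects free): the component identity for the arrows `log`, `φ_⋏`. [folklore] -/
private theorem g_whisk (K : C ⥤ D) (H : B ⥤ C) {b b' : B} (f : b ⟶ b') :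
    𝟙 (K.obj (H.obj b)) ≫ K.map (𝟙 (H.obj b) ≫ H.map f) = 𝟙 _ ≫ K.map (H.map f) ≫ 𝟙 _ := by
  simp

/-- Bookkeeping (all objects free): the component identity for the arrows `id_⋎`, `𝒩⊞_v → 𝒩_v`, `𝒩_v → ℰ•`. [folklore] -/
private theorem g_id (K : C ⥤ D) (H : B ⥤ C) (b : B) :
    𝟙 (K.obj (H.obj b)) ≫ K.map (𝟙 (H.obj b)) = 𝟙 _ ≫ K.map (H.map (𝟙 b)) ≫ 𝟙 _ := by
  simp

/-- Bookkeeping (all objects free): the component identity for the arrows `λ⊞_{v,ν}`. [folklore] -/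
private theorem g_whisk₂ (K : C ⥤ D) (H : B ⥤ C) {b₀ b b' : B} (h : b₀ = b) (g : b ⟶ b') :
    𝟙 (K.obj (H.obj b₀)) ≫ K.map (𝟙 (H.obj b₀) ≫ H.map (eqToHom h ≫ g)) = eqToHom (by rw [h]) ≫ K.map (H.map g) ≫ 𝟙 _ := by
  subst h
  simp

/-- Bookkeeping (all objects free): the component identity for the arrow `ℰ• → An•[𝒳]`. [folklore] -/
private theorem g_conj (K : C ⥤ D) (H : B ⥤ C) {b b' : B} (u : b ⟶ b') :
    𝟙 (K.obj (H.obj b)) ≫ K.map (𝟙 (H.obj b) ≫ H.map u ≫ 𝟙 (H.obj b')) = 𝟙 _ ≫ K.map (H.map u) ≫ 𝟙 _ := by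
  simp

end Algebra

/-- At every vertex of `D_{An•}` the structure functor of the super-diagram IS abc-iut-L4-t5's plain structure functor followed by
`Th•[Z] → ℰ⊢ ⥲ An⊢` (abc-iut-f-101's table `coreStructFunctor` versus abc-iut-L4-t5's `baseN`: equal functors, vertex by vertex).
[cite: MochizukiAbsTopIII2015, Remark 3.5.1 p.78] -/
noncomputable def holβ : ∀ x : (anShape (Vmod := Vmod) (isArc := isArc)).Vertex,
    (L.holOverE.map L.toCoreMono).N x ≅ ((L.supOver hN hψ).comapAlong (embHol Vmod isArc)).N x
  | ExtVertex.base ⟨.row1 _, _⟩ => Iso.refl _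
  | ExtVertex.base ⟨.core, _⟩ => Iso.refl _
  | ExtVertex.base ⟨.nplus _, _⟩ => Iso.refl _
  | ExtVertex.base ⟨.nv _, _⟩ => Iso.refl _
  | ExtVertex.base ⟨.e5, _⟩ => Iso.refl _
  | ExtVertex.base ⟨.an, h⟩ => absurd h.2 (by change ¬ (6 ≤ 5); decide)
  | ExtVertex.base ⟨.e7, h⟩ => absurd h.2 (by change ¬ (7 ≤ 5); decide)
  | ExtVertex.base ⟨.nmonoPlus _, h⟩ => h.1.elim
  | ExtVertex.base ⟨.nmono _, h⟩ => h.1.elim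
  | ExtVertex.base ⟨.emono5, h⟩ => h.1.elim
  | ExtVertex.base ⟨.anMono, h⟩ => h.1.elim
  | ExtVertex.base ⟨.emono7, h⟩ => h.1.elim
  | ExtVertex.obs => Iso.refl _

/-- **Isomorphism of structure data** (abc-iut-f-101's `OverIso`): abc-iut-L4-t5's structure functors of `D_{An•}` over `Th•[Z]`
followed by `Th•[Z] → ℰ⊢ ⥲ An⊢`, versus the structure functors of the super-diagram over the core `An⊢[𝒩⊢⊞]` restricted along
`embHolSuper`: the same functors, and — edge by edge — the same over-isomorphisms (`logOver`, unitors, `lamOver`, the unit of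
`κ_{An•}`, `φ_{An•} ⋙ proj ≅ κ_{An•}⁻¹`, mono-analyticised). [cite: MochizukiAbsTopIII2015, Remark 3.5.1 p.78] -/
noncomputable def holSupOverIso :
    OverData.OverIso (L.holOverE.map L.toCoreMono) ((L.supOver hN hψ).comapAlong (embHol Vmod isArc)) where
  β := L.holβ hN hψ
  comm {x y} e z := by
    rcases x with ⟨xv, hx⟩ | _ <;> rcases y with ⟨yv, hy⟩ | _
    · change DEdge isArc xv yv at e
      cases e with
      | log n => exact g_whisk L.κAnMono.functor L.monoAn _
      | toCore n => exact g_id L.κAnMono.functor L.monoAn _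
      | lam v ν hν => exact g_whisk₂ L.κAnMono.functor L.monoAn rfl _
      | forget v => exact g_id L.κAnMono.functor L.monoAn _
      | toE v => exact g_id L.κAnMono.functor L.monoAn _
      | κAn => exact absurd hy.2 (by change ¬ (6 ≤ 5); decide)
      | anToE => exact absurd hy.2 (by change ¬ (7 ≤ 5); decide)
      | monoNplus v => exact hy.1.elim
      | monoN v => exact hy.1.elim
      | monoE5 => exact hy.1.elim
      | monoAn => exact hy.1.elim
      | monoE7 => exact hy.1.elim
      | forgetMono w => exact hy.1.elim
      | toEmono w => exact hy.1.elim
      | κAnMono => exact hy.1.elim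
      | anMonoToE => exact hy.1.elim
    · change DEdge isArc xv .an at e
      cases e with
      | κAn => exact g_conj L.κAnMono.functor L.monoAn _
    · rcases yv with ⟨k⟩ | _ | ⟨w⟩ | ⟨w⟩ | _ | _ | _ | ⟨w⟩ | ⟨w⟩ | _ | _ | _
      · exact g_whisk L.κAnMono.functor L.monoAn _
      · exact g_whisk L.κAnMono.functor L.monoAn _
      · exact PEmpty.elim e
      · exact PEmpty.elim e
      · exact PEmpty.elim e
      · exact absurd hy.2 (by change ¬ (6 ≤ 5); decide)
      · exact absurd hy.2 (by change ¬ (7 ≤ 5); decide)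
      · exact hy.1.elim
      · exact hy.1.elim
      · exact hy.1.elim
      · exact hy.1.elim
      · exact hy.1.elim
    · exact PEmpty.elim e

/-- `whiskerRight` of an `eqToHom` is an `eqToHom` (bookkeeping). [folklore] -/
private theorem whiskerRight_eqToHom_aux {A B C' : Type*} [Category A] [Category B] [Category C'] {F G : A ⥤ B} (h : F = G)
    (H : B ⥤ C') : Functor.whiskerRight (eqToHom h) H = eqToHom (by rw [h]) := by
  subst h
  simp

/-- ★ **Every homotopy of `D_{An•}` lying over `Th•[Z]` is, read in the super-diagram, a homotopy lying over the core `An⊢[𝒩⊢⊞]`**: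
over `Th•[Z]` ⇒ over `Th•[Z] → ℰ⊢ ⥲ An⊢` (abc-iut-f-101's `IsOver.map`) ⇒ over the restriction of `supOver` (isomorphic structure data,
`holSupOverIso`) ⇒ over `supOver` on the image pair (along `F^*`).  This is what lets the telecore family `𝒥_{An•}` and its contact
structure be PUSHED into the mono-analytic core `An⊢`. [cite: MochizukiAbsTopIII2015, Cor 5.10 (iv)(c) p. 148] -/
theorem isOver_sup_of_isOver_hol {a b : (anShape (Vmod := Vmod) (isArc := isArc)).Vertex} {P Q : Path a b}
    {θ : (L.supDiagram.comapAlong (embHol Vmod isArc)).pathFunctor P ⟶ (L.supDiagram.comapAlong (embHol Vmod isArc)).pathFunctor Q}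
    (h : L.holOverE.IsOver P Q θ) :
    (L.supOver hN hψ).IsOver ((embHol Vmod isArc).mapPath P) ((embHol Vmod isArc).mapPath Q)
      (eqToHom (L.supDiagram.pathFunctor_comapAlong (embHol Vmod isArc) P).symm ≫ θ ≫
        eqToHom (L.supDiagram.pathFunctor_comapAlong (embHol Vmod isArc) Q)) := by
  -- over `Th•[Z]` ⇒ over `Th•[Z] → ℰ⊢ ⥲ An⊢` ⇒ over the (isomorphic) restriction of `supOver` …
  have h' : ((L.supOver hN hψ).comapAlong (embHol Vmod isArc)).IsOver P Q θ :=
    (L.holSupOverIso hN hψ).isOver (h.map L.toCoreMono)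
  -- … ⇒ over `supOver` on the image pair (abc-iut-w6-d023's `pathIso_comapAlong`)
  unfold OverData.IsOver at h' ⊢
  rw [(L.supOver hN hψ).pathIso_comapAlong (embHol Vmod isArc) P,
    (L.supOver hN hψ).pathIso_comapAlong (embHol Vmod isArc) Q] at h'
  rw [Functor.whiskerRight_comp, Functor.whiskerRight_comp, whiskerRight_eqToHom_aux, whiskerRight_eqToHom_aux]
  simp only [Iso.trans_hom, Iso.trans_inv, eqToIso.hom, eqToIso.inv, Category.assoc] at h'
  rw [eqToHom_comp_iff, comp_eqToHom_iff]
  simp only [Category.assoc]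
  exact h'

end Transfer

end LogFrobeniusSetting

end Literature.AnabelianGeometry.AbsoluteAnabelian
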